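import Summits.QuantumFields.BalabanUV.T4Continuum.Support.ShellMeasureLevelZeroBoxWitness

/-!
# `T4Continuum.ShellMeasureLevelZeroWindowWitness` — rule G-1 (x1) for the WINDOW faces of level 0 (S34 `SU(N)` and the `SU(2)`
# face p206694): the «interior plaquettes of the block» family is jointly inhabited and the faces fire
(cell `pub-balaban`, sub-cell `t4`, spine estimate NE7c (node U5b); NE7c ROUND-2 crew, unit
`b2b-balaban-t4-ne7c-formalise-leaf-10` gen 11; row S89 f3 (S89 = rule G-1 retro-fit at level 0: f1 `ShellMeasureLevelZeroBoxWitness`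
p229619 — the GAUGE-INVARIANT faces S11 ∕ S19 §1 ∕ S44; f2 `ShellMeasureLevelZeroShellMass` — positive shell mass; this f3 — the
older WINDOW faces «(LR)₀ assumed as the window»: this lineage's S34 `ShellMeasureWilsonRealizedSUN.slotAntiConcentration_wilson_suN`
(p217135) and the owner's `ShellMeasureWilsonRealizedSU2.slotAntiConcentration_wilson_su2` (p206694)); ADDITIVE — imports S89 f1 ONLY;
[folklore]; 0 `def`, 0 `def … : Prop`, 0 sorry, 0 citation tags)

HONEST FRAMING.  Finite four-torus programme, rung (B)+1 only — NOT infinite volume, NOT a mass gap, NOT the Clay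
problem, NOT summit progress; (B), `BetaPertHyp`, (B^μ) not consumed.  NE7c (`T4IndicatorShell.ShellWeightBound`) is NOT
PRINTED in [Balaban 1983–89] and NOT PROVED; «NE7c ⇐ the named binders».  (M1)₀ realized ≠ NE7c; the level-0 faces serve
`K ≤ N₁` only.  A CONSISTENCY CERTIFICATE of the combinatorial hypothesis family of OUR window faces; nothing of Bałaban's.
HONEST DEPENDENCY (cell): continuum YM on T⁴ ⇐ BetaPertH ∧ nine spine estimates (0/9 proved); BetaPertH ⇐ (D1) ∧ (D4) ∧
CAP+tail; G-an2-4 gates asym, D1 and NE2/3/4.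

THE POINT.  The window faces take a block `Λ` (any finite bond set), a NONEMPTY classifier set `P_u` of plaquettes with ALL FOUR
bonds in `Λ` (`hPuΛ`), a weight set `P_w`, (SU(2)) an enumeration `e : ↥Λ × Fin 3 ≃ Fin n`, and numbers.  Unlike S77's star ∕ boundary
pair this family is inhabited on EVERY torus by the four bonds of ONE plaquette: `Λ := plaqBonds p` (§1, nonempty), `P_u := {p}`;
§2 fires both faces BY NAME with the explicit numbers `S = 10⁻⁴`, `θ = 2·10⁻⁵`, `δ = ½`, `ρ = ¼` (S21 `sm0_of_window`; the `SU(N)`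
face's `4S`-form (SM)₀ follows from the `8S`-form by monotonicity, `sm_four_of_eight`).  NOT HERE: positive shell mass for the window
faces (f2's argument adapts; not needed for (x1)).  NOTHING in the countdown moves; NE7c NOT PROVED; spine 0∕9.
-/

noncomputable section

open Set Function MeasureTheory

namespace Summit.QuantumFields.BalabanUV.T4Continuum.ShellMeasureLevelZeroWindowWitness

open scoped ENNReal Matrix.Norms.L2Operator
open Literature.MathematicalPhysics.QuantumFieldTheory.Balaban1983to89
open T4ShellMeasure (SlotAntiConcentration)
open T4CubeChartGnomonic (SU2)
open ShellMeasureExpChartSUN (SUN dimSU)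
open ShellMeasureSmallnessArithmetic (sm0_of_window)

variable {P : Params} {j : ℕ}

/-! ## §1 The four bonds of one plaquette as a block -/

section OnePlaquette

variable [DecidableEq (PBond P j)]

/-- the four bonds of `p` lie in `{b₁, b₂, b₃, b₄}` — the window faces' `hPuΛ` for `Λ := {b₁, b₂, b₃, b₄}`, `P_u := {p}`. [folklore] -/
theorem hPuΛ_single (p : Plaq P j) :
    ∀ q ∈ ({p} : Finset (Plaq P j)),
      (⟨q.src, q.μ⟩ : PBond P j) ∈ ({⟨p.src, p.μ⟩, ⟨p.src.shift p.μ, p.ν⟩, ⟨p.src.shift p.ν, p.μ⟩, ⟨p.src, p.ν⟩} :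
          Finset (PBond P j)) ∧
      (⟨q.src.shift q.μ, q.ν⟩ : PBond P j) ∈ ({⟨p.src, p.μ⟩, ⟨p.src.shift p.μ, p.ν⟩, ⟨p.src.shift p.ν, p.μ⟩, ⟨p.src, p.ν⟩} :
          Finset (PBond P j)) ∧
      (⟨q.src.shift q.ν, q.μ⟩ : PBond P j) ∈ ({⟨p.src, p.μ⟩, ⟨p.src.shift p.μ, p.ν⟩, ⟨p.src.shift p.ν, p.μ⟩, ⟨p.src, p.ν⟩} :
          Finset (PBond P j)) ∧
      (⟨q.src, q.ν⟩ : PBond P j) ∈ ({⟨p.src, p.μ⟩, ⟨p.src.shift p.μ, p.ν⟩, ⟨p.src.shift p.ν, p.μ⟩, ⟨p.src, p.ν⟩} :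
          Finset (PBond P j)) := by
  intro q hq
  rw [Finset.mem_singleton] at hq
  subst hq
  simp

/-- the block of one plaquette is nonempty. [folklore] -/
theorem plaqBlock_nonempty (p : Plaq P j) :
    (({⟨p.src, p.μ⟩, ⟨p.src.shift p.μ, p.ν⟩, ⟨p.src.shift p.ν, p.μ⟩, ⟨p.src, p.ν⟩} : Finset (PBond P j))).Nonempty :=
  ⟨⟨p.src, p.μ⟩, by simp⟩

end OnePlaquette

/-! ## §2 The window faces fired -/

/-- the `4S`-form (SM)₀ of the `SU(N)` faces from the `8S`-form of the `SU(2)` faces (monotonicity in the window radius). [folklore] -/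
theorem sm_four_of_eight {S δ θ : ℝ} (hS : 0 ≤ S) (h : 4 * (8 * S) ^ 2 * Real.exp (2 * (8 * S)) ≤ δ * θ) :
    4 * (4 * S) ^ 2 * Real.exp (2 * (4 * S)) ≤ δ * θ := by
  refine le_trans ?_ h
  gcongr <;> nlinarith

/-- **THE `SU(2)` WINDOW FACE (p206694) FIRES ON ONE PLAQUETTE'S BLOCK**, every torus, every plaquette `p`, every `β ≥ 0`, `P_w`:
`Λ := {b₁, b₂, b₃, b₄}` (the bonds of `p`), `P_u := {p}`, `e := Fintype.equivFin`, `S = 10⁻⁴`, `θ = 2·10⁻⁵`, `δ = ½`, `ρ = ¼`.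
[folklore] -/
theorem window_face_su2_inhabited [DecidableEq (PBond P j)] [DecidableEq (Plaq P j)] (p : Plaq P j) {β : ℝ} (hβ : 0 ≤ β) (Pw : Finset (Plaq P j)) :
    SlotAntiConcentration
      ((fieldMeasure P j SU2).withDensity
        (ShellMeasureWilsonRealizedSU2.wilsonF
          ({⟨p.src, p.μ⟩, ⟨p.src.shift p.μ, p.ν⟩, ⟨p.src.shift p.ν, p.μ⟩, ⟨p.src, p.ν⟩} : Finset (PBond P j))
          (1 / 10 ^ 4) β Pw))
      (ShellMeasureWilsonRealizedSU2.wilsonU (Finset.singleton_nonempty p)) (2 / 10 ^ 5) (1 / 4)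
      (2 * (((Fintype.card
          (↥({⟨p.src, p.μ⟩, ⟨p.src.shift p.μ, p.ν⟩, ⟨p.src.shift p.ν, p.μ⟩, ⟨p.src, p.ν⟩} : Finset (PBond P j)) × Fin 3) : ℕ) : ℝ) +
        β * ∑ _p ∈ Pw, (8 * (1 / 10 ^ 4 : ℝ)) * (8 + 4 * (8 * (1 / 10 ^ 4 : ℝ)))) / (1 - 1 / 2)) := by
  have hπ3 := Real.pi_gt_three
  have hSM : 4 * (8 * (1 / 10 ^ 4 : ℝ)) ^ 2 * Real.exp (2 * (8 * (1 / 10 ^ 4 : ℝ))) ≤ 1 / 2 * (2 / 10 ^ 5) :=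
    sm0_of_window (by norm_num) (by norm_num)
  exact ShellMeasureWilsonRealizedSU2.slotAntiConcentration_wilson_su2 _ (Fintype.equivFin _) (by norm_num) (by norm_num)
    (by nlinarith) (Finset.singleton_nonempty p) (hPuΛ_single p) Pw hβ (by norm_num) (by norm_num) (by norm_num) (by norm_num)
    (by norm_num) hSM

/-- **THE `SU(N)` WINDOW FACE (S34, p217135) FIRES ON ONE PLAQUETTE'S BLOCK**, every `N ≥ 1`, every torus, every plaquette, every
`β ≥ 0`, `P_w`: same data, (SM)₀ in the `4S` form by `sm_four_of_eight`. [folklore] -/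
theorem window_face_suN_inhabited (N : ℕ) [NeZero N] [DecidableEq (PBond P j)] [DecidableEq (Plaq P j)]
    (p : Plaq P j) {β : ℝ} (hβ : 0 ≤ β)
    (Pw : Finset (Plaq P j)) :
    SlotAntiConcentration
      ((fieldMeasure P j (SUN N)).withDensity
        (ShellMeasureWilsonRealizedSUN.wilsonF (N := N)
          ({⟨p.src, p.μ⟩, ⟨p.src.shift p.μ, p.ν⟩, ⟨p.src.shift p.ν, p.μ⟩, ⟨p.src, p.ν⟩} : Finset (PBond P j))
          (1 / 10 ^ 4) β Pw))
      (ShellMeasureWilsonRealizedSUN.wilsonU (N := N) (Finset.singleton_nonempty p)) (2 / 10 ^ 5) (1 / 4)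
      (2 * ((((({⟨p.src, p.μ⟩, ⟨p.src.shift p.μ, p.ν⟩, ⟨p.src.shift p.ν, p.μ⟩, ⟨p.src, p.ν⟩} : Finset (PBond P j))).card *
          dimSU N : ℕ) : ℝ) + β * ∑ _p ∈ Pw, (4 * (1 / 10 ^ 4 : ℝ)) * (8 + 4 * (4 * (1 / 10 ^ 4 : ℝ)))) / (1 - 1 / 2)) := by
  have hSM : 4 * (8 * (1 / 10 ^ 4 : ℝ)) ^ 2 * Real.exp (2 * (8 * (1 / 10 ^ 4 : ℝ))) ≤ 1 / 2 * (2 / 10 ^ 5) :=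
    sm0_of_window (by norm_num) (by norm_num)
  exact ShellMeasureWilsonRealizedSUN.slotAntiConcentration_wilson_suN _ (by norm_num) (by norm_num)
    (Finset.singleton_nonempty p) (hPuΛ_single p) Pw hβ (by norm_num) (by norm_num) (by norm_num) (by norm_num) (by norm_num)
    (sm_four_of_eight (by norm_num) hSM)

end Summit.QuantumFields.BalabanUV.T4Continuum.ShellMeasureLevelZeroWindowWitness

end
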